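import Literature.MathematicalPhysics.QuantumLattice.TorusSectorGibbsCondEntropyRowPressureInput
import Literature.MathematicalPhysics.QuantumLattice.TorusSectorGibbsPurityBoxBound
import HarnessLib

/-!
# Pressure floors for the entropy rows: exact floors, PURITY-BOX floors, and the `n = 7/8` instances

Topic `MathematicalPhysics/QuantumLattice`; glue between the free-energy route
(`TorusSectorGibbsOpenBoxBound.lean`, `TorusSectorGibbsPurityBoxBound.lean`, `TorusSectorPressureTypeBound.lean`)
and the entropy rows with a pressure-floor input (`TorusSectorGibbsEntropyRowPressureInput.lean`,
`TorusSectorGibbsCondEntropyRowPressureInput.lean`). The rows take the floor in the `ε`-form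
`hW : ∀ ε > 0, ∀ᶠ j, (W − ε)(Ls j)² ≤ log Re Z_β^{sector}(Ls j)` (the conclusion shape of the type-class certificate
`eventually_typeFreeEntropy_mul_sq_le_log_partitionFn`); the box floors come in the exact form
`∀ᶠ j, ℓ (Ls j)² ≤ log Re Z_β^{sector}(Ls j)`.

* §1 `pressureFloor_of_eventually_mul_sq_le` — exact form ⇒ `ε`-form;
* §2 `eventually_pressureFloor_of_purityBox` — a density matrix `ρ` on the `(a₀,a₀)` sector of the open `a × a`
  box with `Re tr(ρ H_box) ≤ E`, `Re tr(ρ²) ≤ P` (Rényi-2 entropy floor `S(ρ) ≥ −log P`), along box-built tori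
  (`Ls j = K a`, `halfRectN n (Ls j) = K² a₀`): the floor `W = −(log P + βE)/a²`;
* §3 the «ent» and «cent» torus-limit rows with a purity-box free-energy input
  (`…_box_of_purityBox`, `…_window_of_purityBox`): `f⁺ = (log P + βE)/(β a²)` in place of `e(n)`;
* §4 `n = 7/8`: `4 × 4` boxes with `(7,7)` electrons along `Ls j = 4(j+2)` (`eventually_box_seven_eighths`).

Everything is PROVED; no definition, no named fact. The numbers decide whether a box floor beats the zero-entropy
input `W = −β e(n)` (`eventually_pressureFloor_of_energyDensityTT'`); the theorems accept either.

References: Ruelle 1969 §2.5–2.6/§3.3 [Ruelle1969]; Israel 1979 Lemma II.3.1 [Israel1979]; Araki–Moriya 2003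
Thm. 3.8/§10 [ArakiMoriya2003]; Poulin–Hastings 2011 eqs. (3)–(8) [PoulinHastings2011]; LeBlanc et al. 2015
eq. (1) [LeBlancEtAl2015].
-/

noncomputable section

namespace Literature.MathematicalPhysics.QuantumLattice

open Matrix Finset HubbardWave0 ThermodynamicLimit LiebThm1 Literature.Probability.LatticeModels
open Literature.InformationTheory.Entropy (vonNeumannEntropy)
open _root_.Filter
open scoped _root_.Topology ComplexOrder BigOperators

/-! ### §1 Exact floors are `ε`-floors -/

/-- An exact eventual floor `ℓ (Ls j)² ≤ log Re Z(Ls j)` gives the `ε`-form `(ℓ − ε)(Ls j)² ≤ log Re Z(Ls j)` used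
by the entropy rows. [cite: Israel1979, Lemma II.3.1] -/
theorem pressureFloor_of_eventually_mul_sq_le (t t' U n β : ℝ) {Ls : ℕ → ℕ} {ℓ : ℝ}
    (hℓ : ∀ᶠ j in atTop, ℓ * (Ls j : ℝ) ^ 2 ≤ Real.log (partitionFn β (sectorHamiltonianTT' t t' U n (Ls j))).re)
    {ε : ℝ} (hε : 0 < ε) :
    ∀ᶠ j in atTop, (ℓ - ε) * (Ls j : ℝ) ^ 2 ≤ Real.log (partitionFn β (sectorHamiltonianTT' t t' U n (Ls j))).re := by
  filter_upwards [hℓ] with j hj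
  have h2 : (0 : ℝ) ≤ (Ls j : ℝ) ^ 2 := by positivity
  nlinarith

/-! ### §2 The purity-box pressure floor -/

/-- **Purity-box pressure floor.** `0 ≤ n`, `β ≥ 0`; a density matrix `ρ` on the `(a₀,a₀)`-electron sector of
the open `a × a` box (`1 ≤ a`, `a₀ ≤ a²`) with `Re tr(ρ H^open_{a×a}(t,t',U)|_{(a₀,a₀)}) ≤ E` and purity
`Re tr(ρ²) ≤ P`; tori eventually of the form `Ls j = K a`, `K ≥ 2`, `halfRectN n (Ls j) = K² a₀`. Then for every
`ε > 0`, eventually `(−(log P + βE)/a² − ε)(Ls j)² ≤ log Re Z_β(sectorHamiltonianTT' t t' U n (Ls j))`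
(Gibbs variational principle with the Rényi-2 entropy floor on the box, `e^{−log P − βE} ≤ Z_box`; sub-box product
trial states on the torus). [cite: Ruelle1969, §3.3] [cite: Israel1979, Lemma II.3.1] -/
theorem eventually_pressureFloor_of_purityBox (t t' U n : ℝ) {β : ℝ} (hβ : 0 ≤ β) {Ls : ℕ → ℕ}
    {a a₀ : ℕ} (ha : 1 ≤ a) (ha₀ : a₀ ≤ a * a)
    {ρ : Matrix (Subtype (spinConfig (Λ := Fin a ×ₗ Fin a) a₀ a₀))
      (Subtype (spinConfig (Λ := Fin a ×ₗ Fin a) a₀ a₀)) ℂ}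
    (hρ : ρ.PosSemidef) (htr : ρ.trace = 1) {E P : ℝ}
    (hE : (ρ * spinSectorHamiltonian a₀ a₀ (hubbardOpenBoxTT' a a t t' U)).trace.re ≤ E)
    (hP : (ρ * ρ).trace.re ≤ P)
    (hbox : ∀ᶠ j in atTop, ∃ K, 2 ≤ K ∧ Ls j = K * a ∧ halfRectN n (Ls j) = K * K * a₀)
    {ε : ℝ} (hε : 0 < ε) :
    ∀ᶠ j in atTop, (-(Real.log P + β * E) / (a : ℝ) ^ 2 - ε) * (Ls j : ℝ) ^ 2 ≤
      Real.log (partitionFn β (sectorHamiltonianTT' t t' U n (Ls j))).re := by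
  have hH : (spinSectorHamiltonian a₀ a₀ (hubbardOpenBoxTT' a a t t' U)).IsHermitian :=
    isHermitian_spinSectorHamiltonian a₀ a₀ (hubbardOpenBoxTT'_isHermitian a a t t' U)
  have hz := exp_neg_log_purity_sub_mul_energy_le_partitionFn hH hβ hρ htr hE hP
  have hℓ := InfVolFermionState.eventually_log_openBox_mul_sq_le_log_partitionFn t t' U n hβ ha ha₀
    (Real.exp_pos _) hz hbox
  have e : Real.log (Real.exp (-Real.log P - β * E)) / (a : ℝ) ^ 2 = -(Real.log P + β * E) / (a : ℝ) ^ 2 := by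
    rw [Real.log_exp]; ring
  rw [e] at hℓ
  exact pressureFloor_of_eventually_mul_sq_le t t' U n β hℓ hε

namespace InfVolFermionState

variable {t t' U n β : ℝ} {ω : InfVolFermionState 2} {Ls : ℕ → ℕ}

/-! ### §3 The entropy rows with a purity-box free-energy input -/

/-- **The «ent» row with a purity-box free-energy input.** `ω` a torus limit of the canonical sector Gibbs
states at `β > 0` along `Ls` (`0 ≤ n ≤ 2`), box data `(a, a₀, ρ, E, P)` and `hbox` as in
`eventually_pressureFloor_of_purityBox`, a rectangle `B = ∏[0,m_i)` and a Hermitian witness `G ∈ 𝔄_B`: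
`e_Φ(ω) − Re ω_B(G)/(β|B|) ≤ (log P + βE)/(β a²) + log Re Tr e^{−G}/(β|B|)`.
[cite: Israel1979, Lemma II.3.1] [cite: ArakiMoriya2003, Theorem 3.8 and §10] -/
theorem IsTorusLimitOfMixture.meanEnergy_sub_re_expect_div_le_of_sectorGibbs_box_of_purityBox
    (hn0 : 0 ≤ n) (hn2 : n ≤ 2) (hβ : 0 < β)
    (h : ω.IsTorusLimitOfMixture (sectorGibbsCount n) (fun L => sectorGibbsWeightTT' β t t' U n L)
      (fun L => sectorGibbsVectorTT' t t' U n L) Ls)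
    (hLs : Tendsto Ls atTop atTop) {a a₀ : ℕ} (ha : 1 ≤ a) (ha₀ : a₀ ≤ a * a)
    {ρ : Matrix (Subtype (spinConfig (Λ := Fin a ×ₗ Fin a) a₀ a₀))
      (Subtype (spinConfig (Λ := Fin a ×ₗ Fin a) a₀ a₀)) ℂ}
    (hρ : ρ.PosSemidef) (htr : ρ.trace = 1) {E P : ℝ}
    (hE : (ρ * spinSectorHamiltonian a₀ a₀ (hubbardOpenBoxTT' a a t t' U)).trace.re ≤ E)
    (hP : (ρ * ρ).trace.re ≤ P)
    (hbox : ∀ᶠ j in atTop, ∃ K, 2 ≤ K ∧ Ls j = K * a ∧ halfRectN n (Ls j) = K * K * a₀)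
    {m : Fin 2 → ℕ} (hm : ∀ i, 0 < m i) {G : FermionOp (halfOpenRect m)} (hG : G.IsHermitian) :
    ω.meanEnergy (hubbardTTPrimeFermionInteraction t t' U) 1 -
        1 / (β * ∏ i, (m i : ℝ)) * (ω.expect (halfOpenRect m) G).re ≤
      (Real.log P + β * E) / (β * (a : ℝ) ^ 2) + Real.log (partitionFn 1 G).re / (β * ∏ i, (m i : ℝ)) := by
  have hrow := h.meanEnergy_sub_re_expect_div_le_of_sectorGibbs_box_of_pressureFloor t t' U hn0 hn2 hβ hLs
    (fun ε hε => eventually_pressureFloor_of_purityBox t t' U n hβ.le ha ha₀ hρ htr hE hP hbox hε) hm hG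
  exact hrow.trans (le_of_eq (by ring))

/-- **The «cent» row with a purity-box free-energy input.** Same `ω`, box data and `hbox`; a window `Λ ⊆ [0,ℓ)²`
with lexicographically largest site `a'`, `H ∈ 𝔄_Λ` and any conditional free-energy bound
`∀σ: S(σ) − S(σ_{Λ∖a'}) − Re tr(σH) ≤ c`:  `e_Φ(ω) − Re ω_Λ(H)/β ≤ (log P + βE)/(β a²) + c/β`.
[cite: PoulinHastings2011, eqs. (3)–(8)] [cite: Israel1979, Lemma II.3.1] -/
theorem IsTorusLimitOfMixture.meanEnergy_sub_re_expect_div_le_of_sectorGibbs_window_of_purityBox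
    (hn0 : 0 ≤ n) (hn2 : n ≤ 2) (hβ : 0 < β)
    (h : ω.IsTorusLimitOfMixture (sectorGibbsCount n) (fun L => sectorGibbsWeightTT' β t t' U n L)
      (fun L => sectorGibbsVectorTT' t t' U n L) Ls)
    (hLs : Tendsto Ls atTop atTop) {a a₀ : ℕ} (ha : 1 ≤ a) (ha₀ : a₀ ≤ a * a)
    {ρ : Matrix (Subtype (spinConfig (Λ := Fin a ×ₗ Fin a) a₀ a₀))
      (Subtype (spinConfig (Λ := Fin a ×ₗ Fin a) a₀ a₀)) ℂ}
    (hρ : ρ.PosSemidef) (htr : ρ.trace = 1) {E P : ℝ}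
    (hE : (ρ * spinSectorHamiltonian a₀ a₀ (hubbardOpenBoxTT' a a t t' U)).trace.re ≤ E)
    (hP : (ρ * ρ).trace.re ≤ P)
    (hbox : ∀ᶠ j in atTop, ∃ K, 2 ≤ K ∧ Ls j = K * a ∧ halfRectN n (Ls j) = K * K * a₀)
    {Λ : Finset (Site 2)} {a' : Site 2} (ha' : a' ∈ Λ) (hmax : ∀ y ∈ Λ, toLex y ≤ toLex a') {ℓ : ℕ}
    (hΛ : Λ ⊆ halfOpenBox 2 ℓ) (H : FermionOp Λ) {c : ℝ}
    (hrow : ∀ σ : FermionOp Λ, σ.PosSemidef → σ.trace = 1 →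
      vonNeumannEntropy σ - vonNeumannEntropy (fermionPartialTrace (PolySite.incl (Finset.erase_subset a' Λ)) σ) -
        (σ * H).trace.re ≤ c) :
    ω.meanEnergy (hubbardTTPrimeFermionInteraction t t' U) 1 - 1 / β * (ω.expect Λ H).re ≤
      (Real.log P + β * E) / (β * (a : ℝ) ^ 2) + c / β := by
  have hrow' := h.meanEnergy_sub_re_expect_div_le_of_sectorGibbs_window_of_pressureFloor t t' U hn0 hn2 hβ hLs
    (fun ε hε => eventually_pressureFloor_of_purityBox t t' U n hβ.le ha ha₀ hρ htr hE hP hbox hε) ha' hmax hΛ H hrow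
  exact hrow'.trans (le_of_eq (by ring))

/-! ### §4 The `n = 7/8` instances: `4 × 4` boxes with `(7,7)` electrons along `Ls j = 4(j+2)` -/

/-- **«ent» row at `n = 7/8` with a `4 × 4` purity box.** For every torus limit `ω` of the canonical sector Gibbs
states of `hubbardTorusTT' L t t' U` on `(N↑ = N↓ = ⌊7L²/16⌋)` at `β > 0` along the box-built tori
`Ls j = 4(j+2)`, every density matrix `ρ` on the `(7,7)` sector of the open `4 × 4` box with `Re tr(ρH) ≤ E`,
`Re tr(ρ²) ≤ P`, every rectangle `B` and Hermitian witness `G ∈ 𝔄_B`: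
`e_Φ(ω) − Re ω_B(G)/(β|B|) ≤ (log P + βE)/(16β) + log Re Tr e^{−G}/(β|B|)`. [cite: LeBlancEtAl2015, eq. (1)]
[cite: Israel1979, Lemma II.3.1] -/
theorem IsTorusLimitOfMixture.meanEnergy_sub_re_expect_div_le_of_sectorGibbs_box_of_purityBox_seven_eighths
    (hβ : 0 < β)
    (h : ω.IsTorusLimitOfMixture (sectorGibbsCount (7 / 8)) (fun L => sectorGibbsWeightTT' β t t' U (7 / 8) L)
      (fun L => sectorGibbsVectorTT' t t' U (7 / 8) L) (fun j => 4 * (j + 2)))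
    {ρ : Matrix (Subtype (spinConfig (Λ := Fin 4 ×ₗ Fin 4) 7 7)) (Subtype (spinConfig (Λ := Fin 4 ×ₗ Fin 4) 7 7)) ℂ}
    (hρ : ρ.PosSemidef) (htr : ρ.trace = 1) {E P : ℝ}
    (hE : (ρ * spinSectorHamiltonian 7 7 (hubbardOpenBoxTT' 4 4 t t' U)).trace.re ≤ E)
    (hP : (ρ * ρ).trace.re ≤ P)
    {m : Fin 2 → ℕ} (hm : ∀ i, 0 < m i) {G : FermionOp (halfOpenRect m)} (hG : G.IsHermitian) :
    ω.meanEnergy (hubbardTTPrimeFermionInteraction t t' U) 1 -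
        1 / (β * ∏ i, (m i : ℝ)) * (ω.expect (halfOpenRect m) G).re ≤
      (Real.log P + β * E) / (β * 16) + Real.log (partitionFn 1 G).re / (β * ∏ i, (m i : ℝ)) := by
  have hLs : Tendsto (fun j : ℕ => 4 * (j + 2)) atTop atTop :=
    tendsto_atTop_mono (fun j : ℕ => (show j ≤ 4 * (j + 2) by omega)) tendsto_id
  have h16 := h.meanEnergy_sub_re_expect_div_le_of_sectorGibbs_box_of_purityBox (by norm_num) (by norm_num) hβ hLs
    (a := 4) (a₀ := 7) (by norm_num) (by norm_num) hρ htr hE hP eventually_box_seven_eighths hm hG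
  norm_num at h16 ⊢
  exact h16

end InfVolFermionState

end Literature.MathematicalPhysics.QuantumLattice

end
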